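import Summits.CriticalPhenomena.Ising3DConformalLimit.Theorems.EnergyNotSigmaSquaredGapForcesFarMergingSandwichDoubleSandwich
import Literature.Probability.LatticeModels.UrsellMonotonicityTwo
import HarnessLib

/-!
# The avoidance tilt of a duplicated cluster (line `one-cluster-depletion-sandwich`, crux `GapForcesFarMerging`,
# item stmt-CriticalPhenomena-4468; API for the open stub `stub_avoidanceDomination`)

Finite-graph content, couplings `K ≥ 0` (`epairWeight K A B`, `Z_{G∖T}[∅] = ecurrentSumIn (offGraph G T) K ∅`,
`cutCoupling K X` = the couplings with the edges meeting `X` switched off). For the DUPLICATED cluster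
`C = C_{n₁+n₂}(a)` of a pair `∂n₁ = {a} ∆ {x'}`, `∂n₂ = ∅` and a frozen vertex set `X ∌ a`:

**Tilt identity** (`tsum_avoid_eq_tsum_cut_tilt`): for every `F`,
`∑ 1{∂n₁}1{∂n₂} w w · 𝟙[C ∩ X = ∅] · F(C) = ∑ 1{∂n₁}1{∂n₂} w_X w_X · F(C) · ρ_X(C)²`,
`ρ_X(T) = Z_{G∖T}[∅] / Z_{G∖(X∪T)}[∅]` (`tiltRatio`), `w_X` the weights of the `X`-depleted couplings: conditioning the
duplicated cluster on AVOIDING `X` is the same as running it in the `X`-depleted graph and tilting by `ρ_X(C)²` —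
Aizenman–Duminil-Copin 2021, Lemma A.1, read for the pair `(n₁,n₂)` itself (the tree's frozen-cluster factorisation
`DoubleSandwichProof.clusterEq_mul_sq_eq`, resolved by the value of the cluster).

**The tilt is bounded and antitone** (`one_le_tiltRatio`, `tiltRatio_le`, `tiltRatio_antitone`):
`1 ≤ ρ_X(T) ≤ Z[∅]/Z_{G∖X}[∅]` and `T ⊆ T' ⇒ ρ_X(T') ≤ ρ_X(T)` (Griffiths' super-multiplicativity of the sourceless
partition functions in deleted edges, Aizenman 1982 Lemma 9.3, tree `ecurrentSumIn_offGraph_empty_mul_le`). So the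
conditional law given avoidance is the depleted law reweighted by a DECREASING function of the cluster; avoidance
domination is exactly a negative-correlation statement between an increasing functional of the depleted cluster and
this decreasing density (registered stub `stub_avoidanceDomination`; this file is its finite-graph API).

References: M. Aizenman, H. Duminil-Copin, Ann. of Math. 194 (2021), arXiv:1912.07973, App. A Lemma A.1
[AizenmanDuminilCopinAnnals2021]; M. Aizenman, Comm. Math. Phys. 86 (1982), Lemmas 9.2–9.3 [AizenmanCMP1982].
-/

noncomputable section

namespace Summit.CriticalPhenomena.Ising3DConformalLimit.EnergyNotSigmaSquaredGapForcesFarMergingSandwich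

namespace AvoidanceDominationProof

open scoped symmDiff ENNReal
open Finset
open Literature.Probability.LatticeModels Literature.Probability.LatticeModels.Current DoubleSandwichProof
open Literature.Probability.Percolation (openGraph openGraph_adj)

variable {V : Type*} [Fintype V] [DecidableEq V] {G : SimpleGraph V} [DecidableRel G.Adj]
  {K : G.edgeFinset → ℝ}

/-! ### The tilt ratio `ρ_X(T) = Z_{G∖T}[∅]/Z_{G∖(X∪T)}[∅]` -/

/-- The AVOIDANCE TILT `ρ_X(T) = Z_{G∖T}[∅] / Z_{G∖(X∪T)}[∅]` (sourceless partition functions with the edges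
meeting `T`, resp. `X ∪ T`, switched off). [cite: AizenmanDuminilCopinAnnals2021, arXiv:1912.07973 Appendix A.1, Lemma A.1] -/
def tiltRatio (K : G.edgeFinset → ℝ) (X T : Finset V) : ℝ≥0∞ :=
  ecurrentSumIn (offGraph G T) K ∅ / ecurrentSumIn (offGraph G (X ∪ T)) K ∅

/-- `Z_{G∖S}[∅] ≠ 0`. [folklore] -/
theorem zoff_ne_zero (K : G.edgeFinset → ℝ) (S : Finset V) : ecurrentSumIn (offGraph G S) K ∅ ≠ 0 :=
  ecurrentSumIn_empty_ne_zero _ K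

/-- `Z_{G∖S}[∅] ≠ ∞` for `K ≥ 0`. [folklore] -/
theorem zoff_ne_top (hK : ∀ e, 0 ≤ K e) (S : Finset V) : ecurrentSumIn (offGraph G S) K ∅ ≠ ∞ :=
  ecurrentSumIn_ne_top _ hK ∅

/-- Monotonicity of the sourceless partition function in deleted edges: `Z_{G∖S'}[∅] ≤ Z_{G∖S}[∅]` for
`S ⊆ S'` (fewer admissible currents). [folklore] -/
theorem zoff_anti {S S' : Finset V} (h : S ⊆ S') :
    ecurrentSumIn (offGraph G S') K ∅ ≤ ecurrentSumIn (offGraph G S) K ∅ := by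
  unfold ecurrentSumIn
  refine ENNReal.tsum_le_tsum fun n => ?_
  by_cases hn : IsSupp (offGraph G S') n ∧ n.sources = ∅
  · have hS : IsSupp (offGraph G S) n := by
      have h1 := hn.1
      rw [isSupp_offGraph_iff'] at h1 ⊢
      exact fun e he v hv hvS => h1 e he v hv (h hvS)
    rw [if_pos hn, if_pos ⟨hS, hn.2⟩]
  · rw [if_neg hn]; exact bot_le

/-- **`1 ≤ ρ_X(T)`.** [cite: AizenmanCMP1982, Lemma 9.3] -/
theorem one_le_tiltRatio (hK : ∀ e, 0 ≤ K e) (X T : Finset V) : 1 ≤ tiltRatio K X T := by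
  have h : ecurrentSumIn (offGraph G (X ∪ T)) K ∅ ≤ ecurrentSumIn (offGraph G T) K ∅ :=
    zoff_anti Finset.subset_union_right
  have h' : 1 * ecurrentSumIn (offGraph G (X ∪ T)) K ∅ ≤ ecurrentSumIn (offGraph G T) K ∅ := by
    rwa [one_mul]
  exact (ENNReal.le_div_iff_mul_le (Or.inl (zoff_ne_zero K _)) (Or.inl (zoff_ne_top hK _))).2 h'

/-- `a/b ≤ c/d` in `ℝ≥0∞` from `a·d ≤ c·b` (finite non-zero denominators). [folklore] -/
theorem div_le_div_of_cross {a b c d : ℝ≥0∞} (hb0 : b ≠ 0) (hbt : b ≠ ∞) (hd0 : d ≠ 0) (hdt : d ≠ ∞)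
    (h : a * d ≤ c * b) : a / b ≤ c / d :=
  calc a / b = a * d / (b * d) := (ENNReal.mul_div_mul_right a b hd0 hdt).symm
    _ ≤ c * b / (b * d) := ENNReal.div_le_div_right h _
    _ = c * b / (d * b) := by rw [mul_comm b d]
    _ = c / d := ENNReal.mul_div_mul_right c d hb0 hbt

/-- **`ρ_X(T) ≤ Z[∅]/Z_{G∖X}[∅]`** (Griffiths' super-multiplicativity
`Z_{G∖T}[∅]·Z_{G∖X}[∅] ≤ Z[∅]·Z_{G∖(T∪X)}[∅]`, Aizenman 1982 Lemma 9.3, tree `ecurrentSumIn_offGraph_empty_mul_le`). [cite: AizenmanCMP1982, Lemma 9.3] -/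
theorem tiltRatio_le (hK : ∀ e, 0 ≤ K e) (X T : Finset V) :
    tiltRatio K X T ≤ ecurrentSum K ∅ / ecurrentSumIn (offGraph G X) K ∅ := by
  refine div_le_div_of_cross (zoff_ne_zero K _) (zoff_ne_top hK _) (zoff_ne_zero K _) (zoff_ne_top hK _) ?_
  have key := ecurrentSumIn_offGraph_empty_mul_le hK T X
  rwa [Finset.union_comm T X] at key

/-- **The tilt is ANTITONE in the frozen cluster**: `T ⊆ T' ⇒ ρ_X(T') ≤ ρ_X(T)` — super-multiplicativity run in
the `T`-depleted graph (`cutCoupling K T`): `Z_{G∖T'}·Z_{G∖(X∪T)} ≤ Z_{G∖T}·Z_{G∖(X∪T')}`. [cite: AizenmanCMP1982, Lemma 9.3] -/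
theorem tiltRatio_antitone (hK : ∀ e, 0 ≤ K e) (X : Finset V) {T T' : Finset V} (h : T ⊆ T') :
    tiltRatio K X T' ≤ tiltRatio K X T := by
  refine div_le_div_of_cross (zoff_ne_zero K _) (zoff_ne_top hK _) (zoff_ne_zero K _) (zoff_ne_top hK _) ?_
  -- super-multiplicativity for the couplings cut at `T`
  have key := ecurrentSumIn_offGraph_empty_mul_le (cutCoupling_nonneg hK T) T' X
  rw [ecurrentSumIn_offGraph_cutCoupling T T' ∅, ecurrentSumIn_offGraph_cutCoupling T X ∅,
    ecurrentSumIn_offGraph_cutCoupling T (T' ∪ X) ∅, ← ecurrentSumIn_offGraph_eq_cutCoupling K T ∅,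
    Finset.union_eq_right.2 h, Finset.union_comm T X, ← Finset.union_assoc, Finset.union_comm T T',
    Finset.union_eq_left.2 h, Finset.union_comm T' X] at key
  exact key

/-! ### Clusters of currents living off `X` avoid `X` -/

/-- A current supported off the edges meeting `X` has all its clusters (rooted outside `X`) disjoint from `X`. [folklore] -/
theorem disjoint_cluster_of_isSupp {X : Finset V} {n : Current G} (hn : IsSupp (offGraph G X) n) {a : V}
    (haX : a ∉ X) : Disjoint X (n.cluster a) := by
  rw [isSupp_offGraph_iff'] at hn
  rw [Finset.disjoint_right]
  intro v hv
  rw [mem_cluster_iff] at hv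
  obtain ⟨w⟩ := hv
  -- along a walk from `a`, the endpoint is `a` or the last edge is traced, hence off `X`
  suffices hmain : ∀ (u v : V), (openGraph n.traced).Walk u v → v ∉ X ∨ v = u by
    rcases hmain a v w with h | rfl
    · exact h
    · exact haX
  intro u v w
  induction w with
  | nil => exact Or.inr rfl
  | @cons u b c hadj w' ih =>
    rcases ih with h | rfl
    · exact Or.inl h
    · -- `c = b` is adjacent to `u` by a traced edge
      left
      rw [openGraph_adj] at hadj
      obtain ⟨hmem, _⟩ := hadj
      have he : s(u, c) ∈ G.edgeFinset := by
        obtain ⟨h, _⟩ := hmem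
        exact h
      have hpos : 0 < n ⟨s(u, c), he⟩ := (mem_traced_iff n ⟨s(u, c), he⟩).1 hmem
      exact hn ⟨s(u, c), he⟩ hpos.ne' c (by simp)

/-- Under the couplings cut at `X ∌ a`, the frozen-cluster mass vanishes at every `T` meeting `X`. [folklore] -/
theorem tsum_epairWeight_cut_clusterEq_eq_zero (K : G.edgeFinset → ℝ) (A : Finset V) {a : V} {X T : Finset V}
    (haX : a ∉ X) (hXT : ¬ Disjoint X T) :
    ∑' p : Current G × Current G, epairWeight (cutCoupling K X) A ∅ p *
      (if (p.1 + p.2).cluster a = T then 1 else 0) = 0 := by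
  refine ENNReal.tsum_eq_zero.2 fun p => ?_
  by_cases hT : (p.1 + p.2).cluster a = T
  · rw [epairWeight_cutCoupling]
    split_ifs with h
    · exfalso
      refine hXT ?_
      rw [← hT]
      exact disjoint_cluster_of_isSupp (isSupp_add h.1.1 h.2.1) haX
    · rw [zero_mul]
  · rw [if_neg hT, mul_zero]

/-! ### The tilt identity -/

/-- Frozen-cluster form of the tilt: for `A = {a} ∆ {x'} ⊆ T`, `X ∩ T = ∅`:
`M_K[C = T] = M_{K cut at X}[C = T] · ρ_X(T)²`. [cite: AizenmanDuminilCopinAnnals2021, arXiv:1912.07973 Appendix A.1, Lemma A.1] -/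
theorem clusterEq_eq_cut_mul_tilt_sq (hK : ∀ e, 0 ≤ K e) (a x' : V) {X T : Finset V} (hAT : {a} ∆ {x'} ⊆ T)
    (hXT : Disjoint X T) :
    (∑' p : Current G × Current G, epairWeight K ({a} ∆ {x'}) ∅ p * (if (p.1 + p.2).cluster a = T then 1 else 0)) =
      (∑' p : Current G × Current G, epairWeight (cutCoupling K X) ({a} ∆ {x'}) ∅ p *
          (if (p.1 + p.2).cluster a = T then 1 else 0)) * tiltRatio K X T ^ 2 := by
  have key := clusterEq_mul_sq_eq hK a hAT hXT
  have hZ0 : ecurrentSumIn (offGraph G (X ∪ T)) K ∅ ^ 2 ≠ 0 := pow_ne_zero _ (zoff_ne_zero K _)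
  have hZt : ecurrentSumIn (offGraph G (X ∪ T)) K ∅ ^ 2 ≠ ∞ := ENNReal.pow_ne_top (zoff_ne_top hK _)
  have hsq : tiltRatio K X T ^ 2 =
      ecurrentSumIn (offGraph G T) K ∅ ^ 2 / ecurrentSumIn (offGraph G (X ∪ T)) K ∅ ^ 2 := by
    rw [tiltRatio, div_eq_mul_inv, mul_pow, ← ENNReal.inv_pow, ← div_eq_mul_inv]
  rw [hsq, ← mul_div_assoc, ENNReal.eq_div_iff hZ0 hZt, mul_comm]
  exact key

/-- **Tilt identity (Aizenman–Duminil-Copin 2021, Lemma A.1, for the duplicated cluster itself).** For `K ≥ 0`,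
a pair source set `{a} ∆ {x'}`, a frozen set `X ∌ a` and any `F`:
`∑ 1{∂n₁={a}∆{x'}}1{∂n₂=∅} w w 𝟙[C_{n₁+n₂}(a) ∩ X = ∅] F(C) = ∑ 1{…}1{…} w_X w_X · F(C) · ρ_X(C)²`
(`w_X`: weights of `cutCoupling K X`). [cite: AizenmanDuminilCopinAnnals2021, arXiv:1912.07973 Appendix A.1, Lemma A.1] -/
theorem tsum_avoid_eq_tsum_cut_tilt (hK : ∀ e, 0 ≤ K e) (a x' : V) {X : Finset V} (haX : a ∉ X)
    (F : Finset V → ℝ≥0∞) :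
    ∑' p : Current G × Current G, epairWeight K ({a} ∆ {x'}) ∅ p *
        (if Disjoint X ((p.1 + p.2).cluster a) then F ((p.1 + p.2).cluster a) else 0) =
      ∑' p : Current G × Current G, epairWeight (cutCoupling K X) ({a} ∆ {x'}) ∅ p *
        (F ((p.1 + p.2).cluster a) * tiltRatio K X ((p.1 + p.2).cluster a) ^ 2) := by
  rw [tsum_mul_apply_eq_sum (fun p => epairWeight K ({a} ∆ {x'}) ∅ p) (fun p => (p.1 + p.2).cluster a)
      (fun T => if Disjoint X T then F T else 0),
    tsum_mul_apply_eq_sum (fun p => epairWeight (cutCoupling K X) ({a} ∆ {x'}) ∅ p)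
      (fun p => (p.1 + p.2).cluster a) (fun T => F T * tiltRatio K X T ^ 2)]
  refine Finset.sum_congr rfl fun T _ => ?_
  by_cases hAT : {a} ∆ {x'} ⊆ T
  · by_cases hXT : Disjoint X T
    · rw [if_pos hXT, clusterEq_eq_cut_mul_tilt_sq hK a x' hAT hXT]
      ring
    · rw [if_neg hXT, mul_zero, tsum_epairWeight_cut_clusterEq_eq_zero K _ haX hXT, zero_mul]
  · rw [tsum_epairWeight_clusterEq_eq_zero K hAT, tsum_epairWeight_clusterEq_eq_zero (cutCoupling K X) hAT,
      zero_mul, zero_mul]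

/-- The avoidance mass itself (`F ≡ 1`): `M_K[C ∩ X = ∅] = ∑ w_X w_X ρ_X(C)²` — the normalising constant of the
tilted depleted law. [cite: AizenmanDuminilCopinAnnals2021, arXiv:1912.07973 Appendix A.1, Lemma A.1] -/
theorem tsum_avoid_eq_tsum_cut_tilt_one (hK : ∀ e, 0 ≤ K e) (a x' : V) {X : Finset V} (haX : a ∉ X) :
    ∑' p : Current G × Current G, epairWeight K ({a} ∆ {x'}) ∅ p *
        (if Disjoint X ((p.1 + p.2).cluster a) then 1 else 0) =
      ∑' p : Current G × Current G, epairWeight (cutCoupling K X) ({a} ∆ {x'}) ∅ p *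
        tiltRatio K X ((p.1 + p.2).cluster a) ^ 2 := by
  have h := tsum_avoid_eq_tsum_cut_tilt hK a x' haX (fun _ => 1)
  simpa only [one_mul] using h

end AvoidanceDominationProof

open scoped symmDiff ENNReal in
open Literature.Probability.LatticeModels Literature.Probability.LatticeModels.Current in
/-- **Registered helper `avoidanceDomination_tilt`** (API of stub `stub_avoidanceDomination`): the avoidance mass of a
duplicated cluster w.r.t. a frozen set `X ∌ a` equals the `X`-depleted mass tilted by `ρ_X(C)²`
(`AvoidanceDominationProof.tsum_avoid_eq_tsum_cut_tilt_one`, zero-binder form). [cite: AizenmanDuminilCopinAnnals2021, arXiv:1912.07973 Appendix A.1, Lemma A.1] -/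
theorem avoidanceDomination_tilt : ∀ (V : Type) [Fintype V] [DecidableEq V] (Γ : SimpleGraph V) [DecidableRel Γ.Adj] (K : Γ.edgeFinset → ℝ), (∀ e, 0 ≤ K e) → ∀ (a x' : V) (X : Finset V), a ∉ X → ∑' p : Current Γ × Current Γ, epairWeight K ({a} ∆ {x'}) ∅ p * (if Disjoint X ((p.1 + p.2).cluster a) then 1 else 0) = ∑' p : Current Γ × Current Γ, epairWeight (cutCoupling K X) ({a} ∆ {x'}) ∅ p * AvoidanceDominationProof.tiltRatio K X ((p.1 + p.2).cluster a) ^ 2 := by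
  intro V _ _ Γ _ K hK a x' X haX
  exact AvoidanceDominationProof.tsum_avoid_eq_tsum_cut_tilt_one hK a x' haX

end Summit.CriticalPhenomena.Ising3DConformalLimit.EnergyNotSigmaSquaredGapForcesFarMergingSandwich

end
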